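import Mathlib
import HarnessLib

/-!
# The `k`-line two-vertex contraction in sectorised `L¹–L^∞` norms: one line in `L¹`, the others in sup norm, and the
# SECTOR LEVELS (Feldman–Knörrer–Trubowitz, *Single scale analysis … 3: sectorized norms*, Prop. XII (i) and «three contractions»)

Topic `MathematicalPhysics/QuantumLattice`; companion of `SectorisedKernelNorm` / `SectorisedEffectiveActionBound` (the sectorised
single-scale step) and of `GrassmannKernelYoung` (Young's inequality leg by leg).  The kernels of two even Grassmann polynomials `a`, `b`
presented on position-space SECTOR fields (labels `P × S`: a point and a discrete sector label) are contracted along `k + 1` lines with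
line kernels `L_0, …, L_k` (position-space sectorised propagators); the output kernel, in the size function form
`Q(Z₀, Z₁) = Σ_{X,Y} (∏_i L_i(X_i, Y_i)) · Ka(X; Z₀) · Kb(Y; Z₁)` (contracted legs `X` of `a` against `Y` of `b`, free legs `Z₀` of `a`
and `Z₁` of `b`), is bounded in the `L¹–L^∞` norm pinned at a free leg of `a` by (FKT's device):

* line `0` in `L¹` — its ROW sums `Σ_Y L_0(X,Y) ≤ c` pay the position integral over the relative position of the two vertices;
* lines `i ≥ 1` in sup norm TIMES a sector-diagonality kernel, `L_i((x,σ),(y,τ)) ≤ d_i · D_i(σ,τ)` with `Σ_τ D_i(σ,τ) ≤ r_i`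
  (a scale-`n` propagator between sector fields vanishes unless the sectors overlap: at most three `τ` per `σ`);
* `a` is read with its pinned free leg fixed and EVERYTHING else summed (its `k + 1` contracted legs included): `≤ Na`;
* `b` is read with the label of its line-`0` leg AND THE SECTORS of its other `k` contracted legs FIXED (positions and free legs
  summed): `≤ Nb` — i.e. at a level HIGHER by `k` fixed sectors than its free legs alone would give («`p₁ + p₂ = p + 1`» for
  one line, «`p + 3`» for three lines):

  **`sum_crossContraction_le`**: `Σ_{Z₀ : Z₀ p = z} Σ_{Z₁} Q(Z₀,Z₁) ≤ c · (∏_i d_i r_i) · Na · Nb`.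

* `sum_crossContraction_le_symm` — the same pinned at a free leg of `b` (line `0` by its COLUMN sums, diagonality transposed).

Prescribed output sectors (the tuple sets of `sectorisedKernelNorm`) are encoded by the caller in `Ka`, `Kb` (multiply by the indicator);
momentum-conservation constraint sets likewise.  Pure finite sums of nonnegative reals: no Grassmann algebra, no model.  The bridge from
the Grassmann `k`-fold cross contraction (`…Theorems.KLRegimeWick.crossLaplacian_listProd_copy_mul_copy`) to `Q` is the block product rule
for kernels of a two-copy product (sequel file).

Everything is proved; no definitions, no named facts.

## Sources

J. Feldman, H. Knörrer, E. Trubowitz, *Single scale analysis of many fermion systems. Part 3: Sectorized norms*, Rev. Math. Phys. 15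
(2003) 1121–1169 = arXiv:math-ph/0209042, Prop. XII (i)–(ii) and «three contractions» with its Corollary (`L¹–L^∞` Young step)
[`FeldmanKnorrerTrubowitz2003SectorizedNorms`]; G. Benfatto, A. Giuliani, V. Mastropietro, Ann. Henri Poincaré 7 (2006) 809–898,
§2.8 (2.76)–(2.83) [`BenfattoGiulianiMastropietro2006`].
-/

noncomputable section

open Finset

namespace Literature.MathematicalPhysics.QuantumLattice

section CrossContraction

variable {P S : Type*} [Fintype P] [Fintype S] [DecidableEq P] [DecidableEq S]

/-- Sums over `k + 1`-tuples split into the head and the tail (`Fin.consEquiv`). [folklore] -/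
private theorem sum_pi_succ_eq_sum_sum_cons {α : Type*} [Fintype α] {M : Type*} [AddCommMonoid M] {k : ℕ}
    (f : (Fin (k + 1) → α) → M) : ∑ Y : Fin (k + 1) → α, f Y = ∑ y₀ : α, ∑ Yr : Fin k → α, f (Fin.cons y₀ Yr) := by
  rw [← Fintype.sum_prod_type']
  exact (Fintype.sum_equiv (Fin.consEquiv fun _ => α) _ _ fun q => rfl).symm

omit [DecidableEq P] [DecidableEq S] in
/-- Sums over tuples valued in a product split into the two component tuples (`Equiv.arrowProdEquivProdArrow`). [folklore] -/
private theorem sum_pi_prod_eq_sum_sum {M : Type*} [AddCommMonoid M] {k : ℕ} (f : (Fin k → P × S) → M) :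
    ∑ Yr : Fin k → P × S, f Yr = ∑ τ : Fin k → S, ∑ y : Fin k → P, f (fun i => (y i, τ i)) := by
  rw [Finset.sum_comm, ← Fintype.sum_prod_type']
  exact Fintype.sum_equiv (Equiv.arrowProdEquivProdArrow (Fin k) (fun _ => P) (fun _ => S)) _ _ fun Yr => rfl

omit [DecidableEq P] [DecidableEq S] in
/-- **The sector-diagonal sup lines, summed over the partner's contracted labels**: with `L_{i+1}((x,σ),(y,τ)) ≤ d_i D_i(σ,τ)`,
`Σ_τ D_i(σ,τ) ≤ r_i` and `G ≥ 0` bounded by `Nb` once the SECTORS of its arguments are fixed (positions summed),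
`Σ_{Yr} (∏_i L_{i+1}(X_{i+1}, Yr_i)) · G(Yr) ≤ (∏_i d_i r_i) · Nb`.
[cite: FeldmanKnorrerTrubowitz2003SectorizedNorms, Prop. XII («three contractions», the sup-norm lines and sector diagonality)] -/
theorem sum_prod_line_mul_le {k : ℕ} (Lr : Fin k → (P × S) → (P × S) → ℝ) (hLr : ∀ i X Y, 0 ≤ Lr i X Y)
    (D : Fin k → S → S → ℝ) (hD : ∀ i σ τ, 0 ≤ D i σ τ) (d r : Fin k → ℝ) (hd : ∀ i, 0 ≤ d i)
    (hLD : ∀ (i : Fin k) (X Y : P × S), Lr i X Y ≤ d i * D i X.2 Y.2) (hr : ∀ i σ, ∑ τ, D i σ τ ≤ r i)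
    (Xr : Fin k → P × S) (G : (Fin k → P × S) → ℝ) (hG : ∀ Yr, 0 ≤ G Yr) {Nb : ℝ} (hNb0 : 0 ≤ Nb)
    (hNb : ∀ τ : Fin k → S, ∑ y : Fin k → P, G (fun i => (y i, τ i)) ≤ Nb) :
    ∑ Yr : Fin k → P × S, (∏ i, Lr i (Xr i) (Yr i)) * G Yr ≤ (∏ i, d i * r i) * Nb := by
  calc ∑ Yr : Fin k → P × S, (∏ i, Lr i (Xr i) (Yr i)) * G Yr
      ≤ ∑ Yr : Fin k → P × S, (∏ i, d i * D i (Xr i).2 (Yr i).2) * G Yr := by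
        refine sum_le_sum fun Yr _ => mul_le_mul_of_nonneg_right ?_ (hG Yr)
        exact prod_le_prod (fun i _ => hLr i _ _) fun i _ => hLD i _ _
    _ = ∑ τ : Fin k → S, (∏ i, d i * D i (Xr i).2 (τ i)) * ∑ y : Fin k → P, G (fun i => (y i, τ i)) := by
        rw [sum_pi_prod_eq_sum_sum]
        refine sum_congr rfl fun τ _ => ?_
        rw [mul_sum]
    _ ≤ ∑ τ : Fin k → S, (∏ i, d i * D i (Xr i).2 (τ i)) * Nb :=
        sum_le_sum fun τ _ => mul_le_mul_of_nonneg_left (hNb τ) (prod_nonneg fun i _ => mul_nonneg (hd i) (hD i _ _))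
    _ = (∏ i, ∑ t, d i * D i (Xr i).2 t) * Nb := by
        rw [← sum_mul, (Fintype.prod_sum (fun i t => d i * D i (Xr i).2 t)).symm]
    _ = (∏ i, d i * ∑ t, D i (Xr i).2 t) * Nb := by
        congr 1
        exact prod_congr rfl fun i _ => (mul_sum _ _ _).symm
    _ ≤ (∏ i, d i * r i) * Nb := by
        refine mul_le_mul_of_nonneg_right (prod_le_prod (fun i _ => mul_nonneg (hd i) (sum_nonneg fun t _ => hD i _ _))
          fun i _ => mul_le_mul_of_nonneg_left (hr i _) (hd i)) hNb0

/-- **The `k + 1`-line two-vertex contraction, pinned at a free leg of `a`** [cite: FeldmanKnorrerTrubowitz2003SectorizedNorms,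
Prop. XII (i) («`‖Cont_c(φ⊗φ′)‖_p ≤ … max_{p₁+p₂ = p+1}`») and «three contractions» («`p₁ + p₂ = p + 3`») with its Corollary
(the `L¹–L^∞` Young step)]: for nonnegative size functions `Ka(X; Z₀)` (`a`: contracted legs `X : Fin (k+1) → P × S`, free legs `Z₀`)
and `Kb(Y; Z₁)`, line kernels `L_i ≥ 0` with ROW sums of `L_0` at most `c` and `L_{i+1} ≤ d_i·D_i` sector-diagonal
(`Σ_τ D_i(σ,τ) ≤ r_i`), if `a` summed over everything but the pinned free leg `p` is `≤ Na` and `b` summed over its positions and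
free legs WITH THE LABEL OF ITS LINE-`0` LEG AND THE SECTORS OF ITS OTHER CONTRACTED LEGS FIXED is `≤ Nb`, then
`Σ_{Z₀ : Z₀ p = z} Σ_{Z₁} Σ_{X,Y} (∏_i L_i(X_i,Y_i)) Ka(X;Z₀) Kb(Y;Z₁) ≤ c · (∏_i d_i r_i) · Na · Nb`. -/
theorem sum_crossContraction_le {k m₀ m₁ : ℕ} (Ka : (Fin (k + 1) → P × S) → (Fin m₀ → P × S) → ℝ)
    (Kb : (Fin (k + 1) → P × S) → (Fin m₁ → P × S) → ℝ) (hKa : ∀ X Z, 0 ≤ Ka X Z) (hKb : ∀ Y Z, 0 ≤ Kb Y Z)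
    (L : Fin (k + 1) → (P × S) → (P × S) → ℝ) (hL : ∀ i X Y, 0 ≤ L i X Y) {c : ℝ} (hc : ∀ X, ∑ Y, L 0 X Y ≤ c)
    (D : Fin k → S → S → ℝ) (hD : ∀ i σ τ, 0 ≤ D i σ τ) (d r : Fin k → ℝ) (hd : ∀ i, 0 ≤ d i)
    (hLD : ∀ (i : Fin k) (X Y : P × S), L i.succ X Y ≤ d i * D i X.2 Y.2) (hr : ∀ i σ, ∑ τ, D i σ τ ≤ r i)
    (p : Fin m₀) (z : P × S) {Na Nb : ℝ} (hNb0 : 0 ≤ Nb)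
    (hNa : ∑ X : Fin (k + 1) → P × S, ∑ Z₀ ∈ univ.filter (fun Z₀ : Fin m₀ → P × S => Z₀ p = z), Ka X Z₀ ≤ Na)
    (hNb : ∀ (Y₀ : P × S) (τ : Fin k → S),
      ∑ y : Fin k → P, ∑ Z₁ : Fin m₁ → P × S, Kb (Fin.cons Y₀ (fun i => (y i, τ i))) Z₁ ≤ Nb) :
    ∑ Z₀ ∈ univ.filter (fun Z₀ : Fin m₀ → P × S => Z₀ p = z), ∑ Z₁ : Fin m₁ → P × S,
        ∑ X : Fin (k + 1) → P × S, ∑ Y : Fin (k + 1) → P × S, (∏ i, L i (X i) (Y i)) * Ka X Z₀ * Kb Y Z₁ ≤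
      c * (∏ i, d i * r i) * Na * Nb := by
  -- constants are nonnegative as soon as they bound something nonnegative
  have hc0 : 0 ≤ c := le_trans (sum_nonneg fun Y _ => hL 0 z Y) (hc z)
  have hdr0 : 0 ≤ ∏ i, d i * r i :=
    prod_nonneg fun i _ => mul_nonneg (hd i) (le_trans (sum_nonneg fun τ _ => hD i z.2 τ) (hr i z.2))
  -- the inner bound: for fixed contracted labels `X` of `a`, the lines and `b` cost `c ∏(d r) Nb`
  have hinner : ∀ X : Fin (k + 1) → P × S,
      ∑ Y : Fin (k + 1) → P × S, (∏ i, L i (X i) (Y i)) * ∑ Z₁ : Fin m₁ → P × S, Kb Y Z₁ ≤ c * (∏ i, d i * r i) * Nb := by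
    intro X
    rw [sum_pi_succ_eq_sum_sum_cons]
    have hsplit : ∀ (y₀ : P × S) (Yr : Fin k → P × S),
        (∏ i, L i (X i) ((Fin.cons y₀ Yr : Fin (k + 1) → P × S) i)) = L 0 (X 0) y₀ * ∏ i : Fin k, L i.succ (X i.succ) (Yr i) := by
      intro y₀ Yr
      rw [Fin.prod_univ_succ]
      simp only [Fin.cons_zero, Fin.cons_succ]
    calc ∑ y₀ : P × S, ∑ Yr : Fin k → P × S,
          (∏ i, L i (X i) ((Fin.cons y₀ Yr : Fin (k + 1) → P × S) i)) * ∑ Z₁ : Fin m₁ → P × S, Kb (Fin.cons y₀ Yr) Z₁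
        = ∑ y₀ : P × S, L 0 (X 0) y₀ * ∑ Yr : Fin k → P × S,
            (∏ i : Fin k, L i.succ (X i.succ) (Yr i)) * ∑ Z₁ : Fin m₁ → P × S, Kb (Fin.cons y₀ Yr) Z₁ := by
          refine sum_congr rfl fun y₀ _ => ?_
          rw [mul_sum]
          refine sum_congr rfl fun Yr _ => ?_
          rw [hsplit, mul_assoc]
      _ ≤ ∑ y₀ : P × S, L 0 (X 0) y₀ * ((∏ i, d i * r i) * Nb) := by
          refine sum_le_sum fun y₀ _ => mul_le_mul_of_nonneg_left ?_ (hL 0 _ _)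
          exact sum_prod_line_mul_le (fun i => L i.succ) (fun i => hL i.succ) D hD d r hd hLD hr (fun i => X i.succ)
            (fun Yr => ∑ Z₁ : Fin m₁ → P × S, Kb (Fin.cons y₀ Yr) Z₁) (fun Yr => sum_nonneg fun Z₁ _ => hKb _ _) hNb0
            (fun τ => hNb y₀ τ)
      _ = (∑ y₀ : P × S, L 0 (X 0) y₀) * ((∏ i, d i * r i) * Nb) := by rw [sum_mul]
      _ ≤ c * ((∏ i, d i * r i) * Nb) := mul_le_mul_of_nonneg_right (hc (X 0)) (mul_nonneg hdr0 hNb0)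
      _ = c * (∏ i, d i * r i) * Nb := by ring
  -- reorganise the left side as `Σ_{Z₀} Σ_X Ka X Z₀ · [Σ_Y (∏ L) Σ_{Z₁} Kb Y Z₁]`
  have hreorg : ∑ Z₀ ∈ univ.filter (fun Z₀ : Fin m₀ → P × S => Z₀ p = z), ∑ Z₁ : Fin m₁ → P × S,
        ∑ X : Fin (k + 1) → P × S, ∑ Y : Fin (k + 1) → P × S, (∏ i, L i (X i) (Y i)) * Ka X Z₀ * Kb Y Z₁ =
      ∑ Z₀ ∈ univ.filter (fun Z₀ : Fin m₀ → P × S => Z₀ p = z), ∑ X : Fin (k + 1) → P × S,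
        Ka X Z₀ * ∑ Y : Fin (k + 1) → P × S, (∏ i, L i (X i) (Y i)) * ∑ Z₁ : Fin m₁ → P × S, Kb Y Z₁ := by
    refine sum_congr rfl fun Z₀ _ => ?_
    calc ∑ Z₁ : Fin m₁ → P × S, ∑ X : Fin (k + 1) → P × S, ∑ Y : Fin (k + 1) → P × S,
          (∏ i, L i (X i) (Y i)) * Ka X Z₀ * Kb Y Z₁
        = ∑ X : Fin (k + 1) → P × S, ∑ Z₁ : Fin m₁ → P × S, ∑ Y : Fin (k + 1) → P × S,
            (∏ i, L i (X i) (Y i)) * Ka X Z₀ * Kb Y Z₁ := sum_comm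
      _ = ∑ X : Fin (k + 1) → P × S, ∑ Y : Fin (k + 1) → P × S, ∑ Z₁ : Fin m₁ → P × S,
            (∏ i, L i (X i) (Y i)) * Ka X Z₀ * Kb Y Z₁ := sum_congr rfl fun X _ => sum_comm
      _ = _ := by
          refine sum_congr rfl fun X _ => ?_
          rw [mul_sum]
          refine sum_congr rfl fun Y _ => ?_
          rw [mul_sum, mul_sum]
          exact sum_congr rfl fun Z₁ _ => by ring
  rw [hreorg]
  calc ∑ Z₀ ∈ univ.filter (fun Z₀ : Fin m₀ → P × S => Z₀ p = z), ∑ X : Fin (k + 1) → P × S,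
        Ka X Z₀ * ∑ Y : Fin (k + 1) → P × S, (∏ i, L i (X i) (Y i)) * ∑ Z₁ : Fin m₁ → P × S, Kb Y Z₁
      ≤ ∑ Z₀ ∈ univ.filter (fun Z₀ : Fin m₀ → P × S => Z₀ p = z), ∑ X : Fin (k + 1) → P × S,
          Ka X Z₀ * (c * (∏ i, d i * r i) * Nb) :=
        sum_le_sum fun Z₀ _ => sum_le_sum fun X _ => mul_le_mul_of_nonneg_left (hinner X) (hKa _ _)
    _ = (∑ Z₀ ∈ univ.filter (fun Z₀ : Fin m₀ → P × S => Z₀ p = z), ∑ X : Fin (k + 1) → P × S, Ka X Z₀) *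
          (c * (∏ i, d i * r i) * Nb) := by
        rw [sum_mul]
        exact sum_congr rfl fun Z₀ _ => by rw [sum_mul]
    _ = (∑ X : Fin (k + 1) → P × S, ∑ Z₀ ∈ univ.filter (fun Z₀ : Fin m₀ → P × S => Z₀ p = z), Ka X Z₀) *
          (c * (∏ i, d i * r i) * Nb) := by
        rw [sum_comm]
    _ ≤ Na * (c * (∏ i, d i * r i) * Nb) := mul_le_mul_of_nonneg_right hNa (mul_nonneg (mul_nonneg hc0 hdr0) hNb0)
    _ = c * (∏ i, d i * r i) * Na * Nb := by ring

/-- **The same, pinned at a free leg of `b`**: line `0` by its COLUMN sums, the sector-diagonality of the other lines read from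
`b`'s side (`Σ_σ D_i(σ,τ) ≤ r_i`), `b` summed over everything but its pinned free leg (`≤ Nb`), `a` with the label of its line-`0`
leg and the sectors of its other contracted legs fixed (`≤ Na`). [cite: FeldmanKnorrerTrubowitz2003SectorizedNorms, Prop. XII
(i) and «three contractions»] -/
theorem sum_crossContraction_le_symm {k m₀ m₁ : ℕ} (Ka : (Fin (k + 1) → P × S) → (Fin m₀ → P × S) → ℝ)
    (Kb : (Fin (k + 1) → P × S) → (Fin m₁ → P × S) → ℝ) (hKa : ∀ X Z, 0 ≤ Ka X Z) (hKb : ∀ Y Z, 0 ≤ Kb Y Z)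
    (L : Fin (k + 1) → (P × S) → (P × S) → ℝ) (hL : ∀ i X Y, 0 ≤ L i X Y) {c : ℝ} (hc : ∀ Y, ∑ X, L 0 X Y ≤ c)
    (D : Fin k → S → S → ℝ) (hD : ∀ i σ τ, 0 ≤ D i σ τ) (d r : Fin k → ℝ) (hd : ∀ i, 0 ≤ d i)
    (hLD : ∀ (i : Fin k) (X Y : P × S), L i.succ X Y ≤ d i * D i X.2 Y.2) (hr : ∀ i τ, ∑ σ, D i σ τ ≤ r i)
    (p : Fin m₁) (z : P × S) {Na Nb : ℝ} (hNa0 : 0 ≤ Na)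
    (hNa : ∀ (X₀ : P × S) (σ : Fin k → S),
      ∑ x : Fin k → P, ∑ Z₀ : Fin m₀ → P × S, Ka (Fin.cons X₀ (fun i => (x i, σ i))) Z₀ ≤ Na)
    (hNb : ∑ Y : Fin (k + 1) → P × S, ∑ Z₁ ∈ univ.filter (fun Z₁ : Fin m₁ → P × S => Z₁ p = z), Kb Y Z₁ ≤ Nb) :
    ∑ Z₁ ∈ univ.filter (fun Z₁ : Fin m₁ → P × S => Z₁ p = z), ∑ Z₀ : Fin m₀ → P × S,
        ∑ X : Fin (k + 1) → P × S, ∑ Y : Fin (k + 1) → P × S, (∏ i, L i (X i) (Y i)) * Ka X Z₀ * Kb Y Z₁ ≤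
      c * (∏ i, d i * r i) * Na * Nb := by
  -- swap the roles of the two vertices: transposed lines, transposed diagonality
  have h := sum_crossContraction_le Kb Ka hKb hKa (fun i X Y => L i Y X) (fun i X Y => hL i Y X) hc
    (fun i σ τ => D i τ σ) (fun i σ τ => hD i τ σ) d r hd (fun i X Y => hLD i Y X) hr p z hNa0 hNb hNa
  calc ∑ Z₁ ∈ univ.filter (fun Z₁ : Fin m₁ → P × S => Z₁ p = z), ∑ Z₀ : Fin m₀ → P × S,
        ∑ X : Fin (k + 1) → P × S, ∑ Y : Fin (k + 1) → P × S, (∏ i, L i (X i) (Y i)) * Ka X Z₀ * Kb Y Z₁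
      = ∑ Z₁ ∈ univ.filter (fun Z₁ : Fin m₁ → P × S => Z₁ p = z), ∑ Z₀ : Fin m₀ → P × S,
          ∑ Y : Fin (k + 1) → P × S, ∑ X : Fin (k + 1) → P × S, (∏ i, L i (X i) (Y i)) * Kb Y Z₁ * Ka X Z₀ := by
        refine sum_congr rfl fun Z₁ _ => sum_congr rfl fun Z₀ _ => ?_
        rw [sum_comm]
        exact sum_congr rfl fun Y _ => sum_congr rfl fun X _ => by ring
    _ ≤ c * (∏ i, d i * r i) * Nb * Na := h
    _ = c * (∏ i, d i * r i) * Na * Nb := by ring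

end CrossContraction

end Literature.MathematicalPhysics.QuantumLattice

end
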